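import Literature.Probability.Process.PoissonSuperposition
import Literature.Probability.Distributions.PoissonCountableAdditivity
import HarnessLib

/-!
# Kingman's random countable set: marks, index sets and the superposition of all batches

J. F. C. Kingman, *Poisson Processes* (Oxford, 1993), §2.5, proof of the Existence Theorem
(pp. 23–24): with independent `Nₙ ~ 𝒫(μₙ(S))`, `X_{nr} ~ μₙ/μₙ(S)`, put `Πₙ = {X_{n1}, …, X_{nNₙ}}`
and `Π = ⋃ₙ Πₙ`; "the Superposition Theorem shows that `Π` is a Poisson process with mean measure
`Σ μₙ`" (§2.2, p. 16: the counts add up, `N(A) = Σₙ Nₙ(A)` (2.21), by the Countable Additivity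
Theorem, and "the double array of variables `Nₙ(A_j)` are all independent").

This file works on the tree's product of batch spaces `cloudMeasure m ρ = ⊗ₙ (𝒫(mₙ) ⊗ ρₙ^{⊗ℕ})`
on `ℕ → ℕ × (ℕ → E)` (`PoissonSuperposition`; batches `PoissonBatch`, `PoissonBatchLaw`) and adds
the random SET and its counts valued in `ℕ∞`:

* `KingmanCloud.mark ω (n, k) = X_{n,k}` — all marks are independent, `X_{n,k} ~ ρₙ`
  (`hasLaw_mark`); `KingmanCloud.cloud ω = ⋃ₙ {X_{n,k} | k < Nₙ}` — Kingman's `Π`;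
  `KingmanCloud.idx s ω = {(n, k) | k < Nₙ, X_{n,k} ∈ s}` — the points in `s` counted WITH
  multiplicity, `#(Π ∩ s) ≤ #idx s` with equality when the marks are distinct;
* `KingmanCloud.hasLaw_encard_idx` — `#idx s ~ 𝒫(Σₙ mₙ ρₙ(s))` (Kingman's `𝒫` on `ℕ∞`,
  `extPoissonMeasure`), DIRECTLY for the total count `#idx s = Σₙ Nₙ(s) ∈ ℕ∞` by the Countable
  Additivity Theorem in random-set form (`PoissonCountableAdditivity.hasLaw_encard_extPoissonMeasure`);
  this supersedes the passage to the limit `M → ∞` in the truncated counts `truncCount M` of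
  `PoissonSuperposition`, which is not needed on this route;
* `KingmanCloud.iIndepFun_encard_idx` — for pairwise disjoint measurable `t₁, …, t_k` the counts
  `#idx t_j` are independent (columns of the independent array `Nₙ(t_j)`,
  `PoissonSuperposition.iIndepFun_pi_of_prod`, composed with the measurable functional
  `w ↦ #{(n, r) | r < wₙ}`);
* `minRep` / `encard_image_eq_encard_minRep` — counting an image `f '' D`, `D ⊆` a countable type,
  by `encode`-minimal representatives: the device by which `#(Π ∩ s)` is seen to be measurable.

`PoissonCloudProofs` consumes `hasLaw_encard_idx` and `iIndepFun_encard_idx`, proves that the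
marks are a.s. distinct, and discharges `exists_isPoissonCloud`.
-/

noncomputable section

open MeasureTheory ProbabilityTheory Set Filter
open scoped ENNReal NNReal Topology

namespace Literature.Probability.Process

open Literature.Probability.Distributions

/-! ### Counting an image by minimal representatives -/

section MinRep

variable {α β : Type*} [Encodable α] (f : α → β) (D : Set α)

/-- The `encode`-minimal representatives of the fibres of `f` on `D`. [folklore] -/
def minRep : Set α := {a ∈ D | ∀ b ∈ D, f b = f a → Encodable.encode a ≤ Encodable.encode b}

/-- `minRep f D ⊆ D`. [folklore] -/
theorem minRep_subset : minRep f D ⊆ D := fun _ h ↦ h.1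

/-- `f` is injective on the minimal representatives. [folklore] -/
theorem injOn_minRep : InjOn f (minRep f D) := fun a ha a' ha' h ↦
  Encodable.encode_injective (le_antisymm (ha.2 a' ha'.1 h.symm) (ha'.2 a ha.1 h))

/-- Every fibre of `f` on `D` has a minimal representative: `f '' minRep f D = f '' D`.
[folklore] -/
theorem image_minRep : f '' minRep f D = f '' D := by
  classical
  refine (image_mono (minRep_subset f D)).antisymm ?_
  rintro _ ⟨a, ha, rfl⟩
  have hex : ∃ n, ∃ b ∈ D, f b = f a ∧ Encodable.encode b = n := ⟨_, a, ha, rfl, rfl⟩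
  obtain ⟨b, hb, hfb, hn⟩ := Nat.find_spec hex
  refine ⟨b, ⟨hb, fun b' hb' h' ↦ ?_⟩, hfb⟩
  rw [hn]
  exact Nat.find_min' hex ⟨b', hb', h'.trans hfb, rfl⟩

/-- `#(f '' D) = #(minRep f D)`. [folklore] -/
theorem encard_image_eq_encard_minRep : (f '' D).encard = (minRep f D).encard := by
  rw [← image_minRep, (injOn_minRep f D).encard_image]

end MinRep

namespace KingmanCloud

variable {E : Type*} [MeasurableSpace E] (m : ℕ → ℝ≥0) (ρ : ℕ → Measure E)
  [∀ n, IsProbabilityMeasure (ρ n)]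

/-! ### The batches and their marks under `cloudMeasure` -/

/-- The `n`-th batch `(N_n, X_{n·})` has the batch law `𝒫(m_n) ⊗ ρ_n^{⊗ℕ}`
(`cloudMeasure_map_eval` as a `HasLaw`). [cite: Kingman1993, §2.5 (2.45), p. 23] -/
theorem hasLaw_eval (n : ℕ) :
    HasLaw (fun ω : ℕ → ℕ × (ℕ → E) ↦ ω n) (batchMeasure (m n) (ρ n)) (cloudMeasure m ρ) :=
  ⟨(measurable_pi_apply n).aemeasurable, cloudMeasure_map_eval m ρ n⟩

/-- `N_n ~ 𝒫(m_n)`. [cite: Kingman1993, §2.5, p. 23] -/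
theorem hasLaw_fst_eval (n : ℕ) :
    HasLaw (fun ω : ℕ → ℕ × (ℕ → E) ↦ (ω n).1) (poissonMeasure (m n)) (cloudMeasure m ρ) := by
  have h : HasLaw Prod.fst (poissonMeasure (m n)) (batchMeasure (m n) (ρ n)) :=
    ⟨measurable_fst.aemeasurable, by rw [batchMeasure, Measure.map_fst_prod]; simp⟩
  exact h.comp (hasLaw_eval m ρ n)

/-- The mark `X_{n,k}` carried by the index `(n, k)`. [cite: Kingman1993, §2.5, p. 23] -/
def mark (ω : ℕ → ℕ × (ℕ → E)) (p : ℕ × ℕ) : E := (ω p.1).2 p.2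

omit [MeasurableSpace E] in
/-- `mark ω (n, k) = (ω n).2 k`. [folklore] -/
@[simp] theorem mark_apply (ω : ℕ → ℕ × (ℕ → E)) (p : ℕ × ℕ) : mark ω p = (ω p.1).2 p.2 := rfl

/-- Each mark is a measurable function of the sample. [folklore] -/
@[fun_prop]
theorem measurable_mark (p : ℕ × ℕ) : Measurable fun ω : ℕ → ℕ × (ℕ → E) ↦ mark ω p :=
  (measurable_pi_apply p.2).comp (measurable_snd.comp (measurable_pi_apply p.1))

/-- **All the marks `X_{n,k}` are independent, `X_{n,k} ~ ρ_n`**: the law of `mark` is the product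
`⊗_{(n,k)} ρ_n`. [cite: Kingman1993, §2.5, p. 23] -/
theorem hasLaw_mark :
    HasLaw (fun ω : ℕ → ℕ × (ℕ → E) ↦ mark ω) (Measure.infinitePi fun p : ℕ × ℕ ↦ ρ p.1)
      (cloudMeasure m ρ) := by
  have hsnd : ∀ n, (batchMeasure (m n) (ρ n)).map Prod.snd = Measure.infinitePi fun _ : ℕ ↦ ρ n :=
    fun n ↦ by rw [batchMeasure, Measure.map_snd_prod]; simp
  have h1 : (cloudMeasure m ρ).map (fun ω n ↦ (ω n).2) =
      Measure.infinitePi fun n ↦ Measure.infinitePi fun _ : ℕ ↦ ρ n := by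
    rw [cloudMeasure, Measure.infinitePi_map_pi _ fun _ ↦ measurable_snd]
    simp_rw [hsnd]
  refine ⟨(measurable_pi_lambda _ measurable_mark).aemeasurable, ?_⟩
  have hcomp : (fun ω : ℕ → ℕ × (ℕ → E) ↦ mark ω) =
      (MeasurableEquiv.curry ℕ ℕ E).symm ∘ fun ω n ↦ (ω n).2 := by
    funext ω p
    rw [MeasurableEquiv.coe_curry_symm]
    rfl
  have hmeas : Measurable fun (ω : ℕ → ℕ × (ℕ → E)) n ↦ (ω n).2 :=
    measurable_pi_lambda _ fun n ↦ measurable_snd.comp (measurable_pi_apply n)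
  rw [hcomp, ← Measure.map_map (MeasurableEquiv.curry ℕ ℕ E).symm.measurable hmeas, h1]
  exact Measure.infinitePi_map_curry_symm fun (n : ℕ) (_ : ℕ) ↦ ρ n

/-! ### The random set and its index sets -/

/-- **Kingman's random countable set** `Π = ⋃_n Π_n`, `Π_n = {X_{n,k} | k < N_n}`.
[cite: Kingman1993, §2.5 (2.46)–(2.47), p. 23] -/
def cloud (ω : ℕ → ℕ × (ℕ → E)) : Set E := {x | ∃ n k, k < (ω n).1 ∧ (ω n).2 k = x}

/-- The indices `(n, k)`, `k < N_n`, of the points `X_{n,k}` of `Π` lying in `s` (points counted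
with multiplicity). [cite: Kingman1993, §2.2 (2.21), p. 16] -/
def idx (s : Set E) (ω : ℕ → ℕ × (ℕ → E)) : Set (ℕ × ℕ) := {p | p.2 < (ω p.1).1 ∧ mark ω p ∈ s}

omit [MeasurableSpace E] in
/-- Membership in `idx`. [folklore] -/
@[simp] theorem mem_idx (s : Set E) (ω : ℕ → ℕ × (ℕ → E)) (p : ℕ × ℕ) :
    p ∈ idx s ω ↔ p.2 < (ω p.1).1 ∧ (ω p.1).2 p.2 ∈ s := Iff.rfl

omit [MeasurableSpace E] in
/-- `idx` is monotone in the test set. [folklore] -/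
theorem idx_mono {s s' : Set E} (h : s ⊆ s') (ω : ℕ → ℕ × (ℕ → E)) : idx s ω ⊆ idx s' ω :=
  fun _ hp ↦ ⟨hp.1, h hp.2⟩

omit [MeasurableSpace E] in
/-- `Π ∩ s` is the image of `idx s` under the marks. [folklore] -/
theorem cloud_inter_eq_image (s : Set E) (ω : ℕ → ℕ × (ℕ → E)) :
    cloud ω ∩ s = mark ω '' idx s ω := by
  ext x
  simp only [cloud, mem_inter_iff, mem_setOf_eq, mem_image, mem_idx, mark_apply, Prod.exists]
  constructor
  · rintro ⟨⟨n, k, hk, rfl⟩, hx⟩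
    exact ⟨n, k, ⟨hk, hx⟩, rfl⟩
  · rintro ⟨n, k, ⟨hk, hx⟩, rfl⟩
    exact ⟨⟨n, k, hk, rfl⟩, hx⟩

omit [MeasurableSpace E] in
/-- `Π` is countable. [cite: Kingman1993, §2.5, p. 23] -/
theorem countable_cloud (ω : ℕ → ℕ × (ℕ → E)) : (cloud ω).Countable := by
  have h : cloud ω = cloud ω ∩ univ := (inter_univ _).symm
  rw [h, cloud_inter_eq_image]
  exact (to_countable _).image _

/-- The events `{(n, k) ∈ idx s}` are measurable. [folklore] -/
theorem measurableSet_mem_idx {s : Set E} (hs : MeasurableSet s) (p : ℕ × ℕ) :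
    MeasurableSet {ω : ℕ → ℕ × (ℕ → E) | p ∈ idx s ω} := by
  have h1 : Measurable fun ω : ℕ → ℕ × (ℕ → E) ↦ (ω p.1).1 :=
    measurable_fst.comp (measurable_pi_apply p.1)
  exact (measurableSet_lt measurable_const h1).inter (hs.preimage (measurable_mark p))

omit [MeasurableSpace E] in
/-- The slice of `idx s` above batch `n` has `N_n(s) = batchCount s (ω n)` elements. [folklore] -/
theorem encard_preimage_mk_idx (s : Set E) (n : ℕ) (ω : ℕ → ℕ × (ℕ → E)) :
    (Prod.mk n ⁻¹' idx s ω).encard = batchCount s (ω n) := by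
  classical
  have h : Prod.mk n ⁻¹' idx s ω = ↑((Finset.range (ω n).1).filter fun k ↦ (ω n).2 k ∈ s) := by
    ext k
    simp
  rw [h, encard_coe_eq_coe_finsetCard, batchCount]

/-! ### The batch counts as random variables on the product space -/

/-- `N_n(s) = batchCount s (ω n)` is measurable. [folklore] -/
theorem measurable_batchCount_eval {s : Set E} (hs : MeasurableSet s) (n : ℕ) :
    Measurable fun ω : ℕ → ℕ × (ℕ → E) ↦ batchCount s (ω n) :=
  (measurable_batchCount hs).comp (measurable_pi_apply n)

/-- `N_n(s) ~ 𝒫(m_n ρ_n(s))` (the batch law of `PoissonBatchLaw` on the product space).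
[cite: Kingman1993, §2.5, p. 24] -/
theorem hasLaw_batchCount_eval {s : Set E} (hs : MeasurableSet s) (n : ℕ) :
    HasLaw (fun ω : ℕ → ℕ × (ℕ → E) ↦ batchCount s (ω n))
      (poissonMeasure (m n * (ρ n s).toNNReal)) (cloudMeasure m ρ) :=
  (hasLaw_batchCount (m n) (ρ n) hs).comp (hasLaw_eval m ρ n)

/-! ### Superposition: the law of the multiplicity counts `#idx s` -/

/-- **Superposition, one set** (Kingman §2.2 (2.21) with the Countable Additivity Theorem): the
number `#idx s = Σ_n N_n(s)` of points in `s`, counted with multiplicity, has Kingman's law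
`𝒫(Σ_n m_n ρ_n(s))` on `ℕ∞`. [cite: Kingman1993, §2.2 Superposition Theorem, p. 16] -/
theorem hasLaw_encard_idx {s : Set E} (hs : MeasurableSet s) :
    HasLaw (fun ω ↦ (idx s ω).encard)
      (extPoissonMeasure (∑' n, ((m n * (ρ n s).toNNReal : ℝ≥0) : ℝ≥0∞))) (cloudMeasure m ρ) :=
  hasLaw_encard_extPoissonMeasure (T := fun n ω ↦ batchCount s (ω n))
    (measurableSet_mem_idx hs) (measurable_batchCount_eval hs) (encard_preimage_mk_idx s)
    (hasLaw_batchCount_eval m ρ hs) (iIndepFun_batchCount_eval m ρ hs)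

/-! ### Superposition: independence over disjoint sets -/

variable {q : ℕ} {t : Fin q → Set E}

/-- **The columns `(N_n(t_j))_n`, `j = 1, …, q`, of the array of batch counts are independent**
("the double array of variables `N_n(A_j)` are all independent, and `N(A_j)` is defined in terms
of a subset of these variables disjoint from those for other `j`"; the array step is as in
`PoissonSuperposition.iIndepFun_truncCount`).
[cite: Kingman1993, §2.2 Superposition Theorem (proof), p. 16] -/
theorem iIndepFun_batchCountSeq (ht : ∀ j, MeasurableSet (t j))
    (hd : Pairwise (Function.onFun Disjoint t)) :
    iIndepFun (fun (j : Fin q) (ω : ℕ → ℕ × (ℕ → E)) ↦ fun n : ℕ ↦ batchCount (t j) (ω n))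
      (cloudMeasure m ρ) := by
  have mX : ∀ (j : Fin q) (n : ℕ), Measurable fun ω : ℕ → ℕ × (ℕ → E) ↦ batchCount (t j) (ω n) :=
    fun j n ↦ measurable_batchCount_eval (ht j) n
  have hrow : iIndepFun (fun n (ω : ℕ → ℕ × (ℕ → E)) ↦ fun j ↦ batchCount (t j) (ω n))
      (cloudMeasure m ρ) :=
    iIndepFun_infinitePi (P := fun n ↦ batchMeasure (m n) (ρ n))
      (X := fun _ b j ↦ batchCount (t j) b) fun _ ↦ measurable_batchCountVec ht
  have hwithin : ∀ n, iIndepFun (fun j (ω : ℕ → ℕ × (ℕ → E)) ↦ batchCount (t j) (ω n))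
      (cloudMeasure m ρ) := fun n ↦
    iIndepFun_comp_of_map_eq (measurable_pi_apply n) (cloudMeasure_map_eval m ρ n)
      (fun j ↦ measurable_batchCount (ht j)) (iIndepFun_batchCount (m n) (ρ n) ht hd)
  have hpair : iIndepFun (fun (p : ℕ × Fin q) (ω : ℕ → ℕ × (ℕ → E)) ↦ batchCount (t p.2) (ω p.1))
      (cloudMeasure m ρ) :=
    iIndepFun_uncurry' (X := fun n j (ω : ℕ → ℕ × (ℕ → E)) ↦ batchCount (t j) (ω n))
      (fun n j ↦ mX j n) hrow hwithin
  exact iIndepFun_pi_of_prod (X := fun j n (ω : ℕ → ℕ × (ℕ → E)) ↦ batchCount (t j) (ω n)) mX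
    (hpair.precomp (g := fun p : Fin q × ℕ ↦ (p.2, p.1)) fun _ _ h ↦ by
      simpa [Prod.ext_iff, and_comm] using h)

omit [MeasurableSpace E] [∀ n, IsProbabilityMeasure (ρ n)] in
/-- `#idx s` is a function of the sequence of batch counts `(N_n(s))_n`: it is the number of pairs
`(n, r)` with `r < N_n(s)` (both are `Σ_n N_n(s)`). [cite: Kingman1993, §2.2 (2.21), p. 16] -/
theorem encard_idx_eq (s : Set E) (ω : ℕ → ℕ × (ℕ → E)) :
    (idx s ω).encard = {p : ℕ × ℕ | p.2 < batchCount s (ω p.1)}.encard := by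
  rw [encard_eq_iSup_sum_encard_preimage_mk, encard_eq_iSup_sum_encard_preimage_mk]
  refine iSup_congr fun F ↦ Finset.sum_congr rfl fun n _ ↦ ?_
  have h : Prod.mk n ⁻¹' {p : ℕ × ℕ | p.2 < batchCount s (ω p.1)} =
      ↑(Finset.range (batchCount s (ω n))) := by
    ext r
    simp
  rw [encard_preimage_mk_idx, h, encard_coe_eq_coe_finsetCard, Finset.card_range]

/-- The functional `w ↦ #{(n, r) | r < w_n}` on `ℕ → ℕ` is measurable. [folklore] -/
theorem measurable_encard_lt : Measurable fun w : ℕ → ℕ ↦ {p : ℕ × ℕ | p.2 < w p.1}.encard :=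
  measurable_encard.comp (measurable_set_iff.2 fun p ↦ measurableSet_setOf.1
    (measurableSet_lt measurable_const (measurable_pi_apply p.1)))

/-- **Superposition, independence** ("we have only to prove that `N(A₁), …, N(A_k)` are
independent if the sets `A_j` are disjoint"): for pairwise disjoint measurable `t₁, …, t_q` the
multiplicity counts `#idx t_j` are independent.
[cite: Kingman1993, §2.2 Superposition Theorem (proof), p. 16] -/
theorem iIndepFun_encard_idx (ht : ∀ j, MeasurableSet (t j))
    (hd : Pairwise (Function.onFun Disjoint t)) :
    iIndepFun (fun j ω ↦ (idx (t j) ω).encard) (cloudMeasure m ρ) := by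
  have h := (iIndepFun_batchCountSeq m ρ ht hd).comp
    (fun _ w ↦ {p : ℕ × ℕ | p.2 < w p.1}.encard) fun _ ↦ measurable_encard_lt
  have heq : (fun (j : Fin q) (ω : ℕ → ℕ × (ℕ → E)) ↦ (idx (t j) ω).encard) = fun j ↦
      (fun w : ℕ → ℕ ↦ {p : ℕ × ℕ | p.2 < w p.1}.encard) ∘ fun ω n ↦ batchCount (t j) (ω n) := by
    funext j ω
    exact encard_idx_eq (t j) ω
  rw [heq]
  exact h

end KingmanCloud

end Literature.Probability.Process
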